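import Summits.RiemannHypothesis.RiemannHypothesis.Theorems.WeilGroundStateGroundStatesConvergeToXiStubZeroSideTruncation
import Summits.RiemannHypothesis.RiemannHypothesis.Theorems.WeilGroundStateGroundStatesConvergeToXiStubPrimeTermTruncation
import Summits.RiemannHypothesis.RiemannHypothesis.Theorems.WeilGroundStateGroundStatesConvergeToXiStubArchPolarTruncation
import Summits.RiemannHypothesis.RiemannHypothesis.Theorems.WeilGroundStateGroundStatesConvergeToXiStubArchBombieriTruncation
import Summits.RiemannHypothesis.RiemannHypothesis.Theorems.WeilGroundStateGroundStatesConvergeToXiStubPhiTranslateHarmonic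
import Summits.RiemannHypothesis.RiemannHypothesis.Theorems.WeilGroundStateGroundStatesConvergeToXiStubPhiConvHarmonic
import Literature.NumberTheory.LFunctions.WeilExplicit
import Literature.NumberTheory.LFunctions.WeilExplicitProofs
import Literature.NumberTheory.LFunctions.WeilExplicitFormulaProofs
import Literature.NumberTheory.LFunctions.WeilExplicitArchTermProofs
import Literature.NumberTheory.LFunctions.WeilZeroSum
import Literature.NumberTheory.LFunctions.RiemannXi
import Literature.Analysis.Calculus.SmoothCutoff
import HarnessLib

/-!
# `WeilGroundState.GroundStatesConvergeToXi` — the explicit formula for the exponential Weil class,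
and the Weil-harmonicity of Riemann's kernel (crux item stmt-RiemannHypothesis-1527, route
route-RiemannHypothesis-WeilGroundState; line `Sketch`, lead c8; `--supports`; RH-free)

The tree's explicit formula `explicit_formula_holds` is stated for Weil TEST functions (smooth of
COMPACT support).  This file assembles, from the four truncation stubs of rev L10 (zero side
`stub_zeroSide_truncation`, prime side `stub_primeTerm_truncation`, archimedean + polar sides
`stub_archPolar_truncation`, Bombieri form `stub_archBombieri_truncation`), the explicit formula for
the EXPONENTIAL WEIL CLASS — smooth `f : ℝ → ℂ` with `‖f‖, ‖f'‖, ‖f''‖ ≤ C e^{-b₀|t|}`, `b₀ > 1/2`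
(Weil 1952's class up to smoothness; it contains the Gaussians, Riemann's kernel `Φ = 2Ψ(2·)`, its
translates and the convolutions `Φ ⋆ g̃` with tests):

* `stub_explicit_formula_expClass` / `explicit_formula_expClass` — **`Σ'_ρ m(ρ) f̂(ρ) = W(f)`**, all
  four sides absolutely convergent, also as the symmetric limit `HasWeilZeroSide f (W f)`.  Proof:
  each plateau truncation `f_R = f · cutoff R` is a test function, so `Σ'_ρ m f̂_R(ρ) = W(f_R)`; let
  `R → ∞` on both sides.
* `weilArchTermBombieri_eq_weilArchTerm_expClass` — Bombieri's archimedean term equals the digamma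
  form on the class (both are limits along the truncations).

and draws the RH-free structural identity behind the crux's limit object:

* `phi_translate_harmonic`, `phi_conv_harmonic` — **Riemann's kernel is WEIL-HARMONIC**:
  `W(Φ(· + t₀)) = 0` for every `t₀` and `W(Φ ⋆ g̃) = 0` for every test `g` (`Φ̂ = ξ` vanishes at every
  non-trivial zero, on the critical line or not; first lemma of the crux idea cards
  `xi-kernel-doob-transform` / `harmonic-weak-limit-closure`, numerically certified to `3.9e-21` in
  job j015519).
* `weilPrimeTerm_sub_weilArchTerm_phi_translate` (digamma form) and
  `weilPrimeTerm_sub_weilArchTermBombieri_phi_translate` (Bombieri form) — the POINTWISE identity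
  `cosh(t/2) = Σ_n Λ(n) n^{-1/2} (Φ(t+log n) + Φ(t-log n)) + (log 4π + γ) Φ(t)
     + ∫₀^∞ (e^{h/2}(Φ(t+h) + Φ(t-h)) - 2Φ(t)) / (2 sinh h) dh`:
  the prime + archimedean Weil operator maps Riemann's kernel to the POLAR eigenfunction `cosh(t/2)`
  (the polar term of `τ_{t}Φ` is `e^{t/2}ξ(0) + e^{-t/2}ξ(1) = cosh(t/2)`).  With
  `∫ Φ cosh(t/2) = (ξ(0) + ξ(1))/2 = 1/2` this makes the window truncation `P_aΦ` an exact-up-to-tails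
  zero-mode of the window Euler–Lagrange operator — the operator form of the energy quasimode
  `Q(φ_a) ≤ C exp(-(π/2)e^{2(a-1)})` (`…EnergyUpper`) and the input of the Doob identity.
No new definitions.
-/

noncomputable section

set_option linter.dupNamespace false

open scoped Topology Real ComplexConjugate ArithmeticFunction.vonMangoldt
open Filter Set MeasureTheory Complex

namespace Summit.RiemannHypothesis.RiemannHypothesis.Theorems.GroundStatesConvergeToXi

open Literature.NumberTheory.LFunctions

/-! ## Truncations are test functions -/

/-- Plateau truncations `f · cutoff R` of a smooth `f` are Weil test functions (smooth, supported
in `[-R, R]`). [folklore] -/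
theorem isWeilTest_mul_cutoff {f : ℝ → ℂ} (hf : ContDiff ℝ (⊤ : ℕ∞) f) (R : ℝ) :
    IsWeilTest (fun t : ℝ => f t * ((Literature.Analysis.Calculus.cutoff R t : ℝ) : ℂ)) := by
  refine ⟨hf.mul (Complex.ofRealCLM.contDiff.comp
    (Literature.Analysis.Calculus.contDiff_cutoff R)), ?_⟩
  refine HasCompactSupport.intro (isCompact_Icc (a := -R) (b := R)) fun t ht => ?_
  have hta : R ≤ |t| := by
    simp only [mem_Icc, not_and_or, not_le] at ht
    rcases ht with h | h
    · linarith [neg_abs_le t]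
    · linarith [le_abs_self t]
  simp [Literature.Analysis.Calculus.cutoff_eq_zero hta]

/-! ## The explicit formula for the exponential Weil class -/

/-- **The explicit formula for the exponential Weil class (registered stub W12d of line `Sketch`,
RH-free).**  For smooth `f` with `‖f‖, ‖f'‖, ‖f''‖ ≤ C e^{-b₀|t|}`, `b₀ > 1/2`: the zero side
`Σ_ρ m(ρ) f̂(ρ)` and the prime series converge absolutely, the archimedean integrand
`f̂(1/2+it) Re ψ(1/4+it/2)` is integrable, and
`Σ'_ρ m(ρ) f̂(ρ) = W(f) = f̂(0) + f̂(1) - Σ_n Λ(n) n^{-1/2} (f(log n) + f(-log n)) + W_∞(f)`, also as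
the symmetric limit over `|Im ρ| ≤ T → ∞`.  Proof: every truncation `f_R = f · cutoff R` is a test
function, so `Σ'_ρ m f̂_R(ρ) = W(f_R)` (`explicit_formula_holds` + `hasWeilZeroSide_tsum` +
uniqueness of limits); then `R → ∞` on the zero side (`stub_zeroSide_truncation`) and on the
prime, archimedean and polar sides (`stub_primeTerm_truncation`, `stub_archPolar_truncation`).
[folklore] -/
theorem stub_explicit_formula_expClass :
    ∀ (f : ℝ → ℂ) (C b₀ : ℝ), ContDiff ℝ (⊤ : ℕ∞) f → 1 / 2 < b₀ →
      (∀ t, ‖f t‖ ≤ C * Real.exp (-(b₀ * |t|))) →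
      (∀ t, ‖deriv f t‖ ≤ C * Real.exp (-(b₀ * |t|))) →
      (∀ t, ‖deriv (deriv f) t‖ ≤ C * Real.exp (-(b₀ * |t|))) →
      Summable (fun ρ : ZetaZeros.riemannZetaNontrivialZeros =>
          ‖(riemannZetaZeroOrder (ρ : ℂ) : ℂ) * weilMellin f ρ‖) ∧
      Summable (fun n : ℕ =>
          ‖((Λ n : ℝ) : ℂ) / (Real.sqrt n : ℂ) * (f (Real.log n) + f (-Real.log n))‖) ∧
      Integrable (fun t : ℝ =>
          weilMellin f (1 / 2 + t * I) * ((Complex.digamma (1 / 4 + t / 2 * I)).re : ℂ)) ∧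
      HasWeilZeroSide f (weilFunctional f) ∧
      ∑' ρ : ZetaZeros.riemannZetaNontrivialZeros,
          (riemannZetaZeroOrder (ρ : ℂ) : ℂ) * weilMellin f ρ = weilFunctional f := by
  intro f C b₀ hf hb₀ h0 h1 h2
  obtain ⟨hZs, hZ⟩ := stub_zeroSide_truncation f C b₀ hf hb₀ h0 h1 h2
  obtain ⟨hPs, hP⟩ := stub_primeTerm_truncation f C b₀ hf hb₀ h0 h1 h2
  obtain ⟨hAi, hA, hPol⟩ := stub_archPolar_truncation f C b₀ hf hb₀ h0 h1 h2
  -- the explicit formula for each truncation, in `tsum` form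
  have hR : ∀ R : ℝ, ∑' ρ : ZetaZeros.riemannZetaNontrivialZeros, (riemannZetaZeroOrder (ρ : ℂ) : ℂ) *
      weilMellin (fun t : ℝ => f t * ((Literature.Analysis.Calculus.cutoff R t : ℝ) : ℂ)) ρ =
      weilFunctional (fun t : ℝ => f t * ((Literature.Analysis.Calculus.cutoff R t : ℝ) : ℂ)) := by
    intro R
    have htest := isWeilTest_mul_cutoff hf R
    exact tendsto_nhds_unique (hasWeilZeroSide_tsum (summable_norm_zeroSide htest))
      (explicit_formula_holds htest)
  -- pass to the limit `R → ∞` on both sides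
  have hW : Tendsto (fun R : ℝ => weilFunctional
      (fun t : ℝ => f t * ((Literature.Analysis.Calculus.cutoff R t : ℝ) : ℂ))) atTop
      (𝓝 (weilFunctional f)) := by
    unfold weilFunctional
    exact (hPol.sub hP).add hA
  have hEq : ∑' ρ : ZetaZeros.riemannZetaNontrivialZeros,
      (riemannZetaZeroOrder (ρ : ℂ) : ℂ) * weilMellin f ρ = weilFunctional f :=
    tendsto_nhds_unique hZ (hW.congr fun R => (hR R).symm)
  exact ⟨hZs, hPs, hAi, hEq ▸ hasWeilZeroSide_tsum hZs, hEq⟩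

/-- **The explicit formula for the exponential Weil class** (curried form of
`stub_explicit_formula_expClass`). [folklore] -/
theorem explicit_formula_expClass
    {f : ℝ → ℂ} {C b₀ : ℝ} (hf : ContDiff ℝ (⊤ : ℕ∞) f) (hb₀ : 1 / 2 < b₀)
    (h0 : ∀ t, ‖f t‖ ≤ C * Real.exp (-(b₀ * |t|)))
    (h1 : ∀ t, ‖deriv f t‖ ≤ C * Real.exp (-(b₀ * |t|)))
    (h2 : ∀ t, ‖deriv (deriv f) t‖ ≤ C * Real.exp (-(b₀ * |t|))) :
    Summable (fun ρ : ZetaZeros.riemannZetaNontrivialZeros =>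
        ‖(riemannZetaZeroOrder (ρ : ℂ) : ℂ) * weilMellin f ρ‖) ∧
    Summable (fun n : ℕ =>
        ‖((Λ n : ℝ) : ℂ) / (Real.sqrt n : ℂ) * (f (Real.log n) + f (-Real.log n))‖) ∧
    Integrable (fun t : ℝ =>
        weilMellin f (1 / 2 + t * I) * ((Complex.digamma (1 / 4 + t / 2 * I)).re : ℂ)) ∧
    HasWeilZeroSide f (weilFunctional f) ∧
    ∑' ρ : ZetaZeros.riemannZetaNontrivialZeros,
        (riemannZetaZeroOrder (ρ : ℂ) : ℂ) * weilMellin f ρ = weilFunctional f :=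
  stub_explicit_formula_expClass f C b₀ hf hb₀ h0 h1 h2

/-- The explicit formula for the class in the two-conjunct shape consumed by the harmonicity stubs
`stub_phi_translate_harmonic` / `stub_phi_conv_harmonic`. [folklore] -/
theorem explicit_formula_expClass' :
    ∀ (f : ℝ → ℂ) (C b₀ : ℝ), ContDiff ℝ (⊤ : ℕ∞) f → 1 / 2 < b₀ →
      (∀ t, ‖f t‖ ≤ C * Real.exp (-(b₀ * |t|))) →
      (∀ t, ‖deriv f t‖ ≤ C * Real.exp (-(b₀ * |t|))) →
      (∀ t, ‖deriv (deriv f) t‖ ≤ C * Real.exp (-(b₀ * |t|))) →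
      Summable (fun ρ : ZetaZeros.riemannZetaNontrivialZeros =>
          ‖(riemannZetaZeroOrder (ρ : ℂ) : ℂ) * weilMellin f ρ‖) ∧
      ∑' ρ : ZetaZeros.riemannZetaNontrivialZeros,
          (riemannZetaZeroOrder (ρ : ℂ) : ℂ) * weilMellin f ρ = weilFunctional f :=
  fun f C b₀ hf hb₀ h0 h1 h2 =>
    let h := stub_explicit_formula_expClass f C b₀ hf hb₀ h0 h1 h2
    ⟨h.1, h.2.2.2.2⟩

/-- **Bombieri's archimedean term equals the digamma form on the exponential Weil class**:
`-((log 4π + γ) f(0) + ∫₀^∞ (e^{h/2}(f(h)+f(-h)) - 2f(0))/(2 sinh h) dh)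
 = (1/2π) ∫ f̂(1/2+it) Re ψ(1/4+it/2) dt - f(0) log π` — both sides are limits of the same
quantities along the truncations (`weilArchTermBombieri_eq_weilArchTerm_holds` on each test function
`f_R`; `stub_archBombieri_truncation`, `stub_archPolar_truncation`). [folklore] -/
theorem weilArchTermBombieri_eq_weilArchTerm_expClass
    {f : ℝ → ℂ} {C b₀ : ℝ} (hf : ContDiff ℝ (⊤ : ℕ∞) f) (hb₀ : 1 / 2 < b₀)
    (h0 : ∀ t, ‖f t‖ ≤ C * Real.exp (-(b₀ * |t|)))
    (h1 : ∀ t, ‖deriv f t‖ ≤ C * Real.exp (-(b₀ * |t|)))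
    (h2 : ∀ t, ‖deriv (deriv f) t‖ ≤ C * Real.exp (-(b₀ * |t|))) :
    weilArchTermBombieri f = weilArchTerm f := by
  obtain ⟨-, hA, -⟩ := stub_archPolar_truncation f C b₀ hf hb₀ h0 h1 h2
  obtain ⟨-, hB⟩ := stub_archBombieri_truncation f C b₀ hf hb₀ h0 h1 h2
  exact tendsto_nhds_unique hB
    (hA.congr fun R => (weilArchTermBombieri_eq_weilArchTerm_holds (isWeilTest_mul_cutoff hf R)).symm)

/-- **The explicit formula for the class with Bombieri's archimedean term**:
`Σ'_ρ m(ρ) f̂(ρ) = f̂(0) + f̂(1) - Σ_n Λ(n) n^{-1/2}(f(log n) + f(-log n)) + weilArchTermBombieri f`.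
[folklore] -/
theorem explicit_formula_expClass_bombieri
    {f : ℝ → ℂ} {C b₀ : ℝ} (hf : ContDiff ℝ (⊤ : ℕ∞) f) (hb₀ : 1 / 2 < b₀)
    (h0 : ∀ t, ‖f t‖ ≤ C * Real.exp (-(b₀ * |t|)))
    (h1 : ∀ t, ‖deriv f t‖ ≤ C * Real.exp (-(b₀ * |t|)))
    (h2 : ∀ t, ‖deriv (deriv f) t‖ ≤ C * Real.exp (-(b₀ * |t|))) :
    ∑' ρ : ZetaZeros.riemannZetaNontrivialZeros,
        (riemannZetaZeroOrder (ρ : ℂ) : ℂ) * weilMellin f ρ =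
      weilPolarTerm f - weilPrimeTerm f + weilArchTermBombieri f := by
  rw [(explicit_formula_expClass hf hb₀ h0 h1 h2).2.2.2.2, weilFunctional,
    weilArchTermBombieri_eq_weilArchTerm_expClass hf hb₀ h0 h1 h2]

/-! ## Riemann's kernel is Weil-harmonic -/

/-- **Riemann's kernel and all its translates are Weil-harmonic (RH-free)**: `W(Φ(· + t₀)) = 0` for
every `t₀ : ℝ`, `Φ(t) = 2Ψ(2t)` — because `(τ_{t₀}Φ)^(s) = e^{-(s-1/2)t₀} ξ(s)` vanishes at every
non-trivial zero of `ζ` (on the critical line or not) and the explicit formula holds on the class.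
[folklore] -/
theorem phi_translate_harmonic (t₀ : ℝ) :
    weilFunctional (fun t : ℝ => (2 : ℂ) * LagariasMontague.Psic (2 * (t + t₀))) = 0 :=
  (stub_phi_translate_harmonic explicit_formula_expClass' t₀).2.2.2

/-- **Riemann's kernel itself is Weil-harmonic**: `W(Φ) = 0`. [folklore] -/
theorem phi_harmonic :
    weilFunctional (fun t : ℝ => (2 : ℂ) * LagariasMontague.Psic (2 * t)) = 0 := by
  simpa using phi_translate_harmonic 0

/-- **Weil-harmonicity in convolution (weak) form (RH-free)**: `W(Φ ⋆ g̃) = 0` for every Weil test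
function `g` — Riemann's kernel is annihilated by the sesquilinear explicit-formula pairing
`(Φ, g) ↦ W(Φ ⋆ g̃)` against the whole form core. [folklore] -/
theorem phi_conv_harmonic {g : ℝ → ℂ} (hg : IsWeilTest g) :
    weilFunctional (weilConv (fun t : ℝ => (2 : ℂ) * LagariasMontague.Psic (2 * t))
      (weilReflect g)) = 0 :=
  (stub_phi_conv_harmonic explicit_formula_expClass' g hg).2

/-- The transform of `Φ ⋆ g̃` in the closed strip: `(Φ ⋆ g̃)^(s) = ξ(s) · conj ĝ(1 - conj s)`.
[folklore] -/
theorem weilMellin_phi_conv_weilReflect {g : ℝ → ℂ} (hg : IsWeilTest g) {s : ℂ}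
    (hs0 : 0 ≤ s.re) (hs1 : s.re ≤ 1) :
    weilMellin (weilConv (fun t : ℝ => (2 : ℂ) * LagariasMontague.Psic (2 * t))
      (weilReflect g)) s = riemannXi s * conj (weilMellin g (1 - conj s)) :=
  (stub_phi_conv_harmonic explicit_formula_expClass' g hg).1 s hs0 hs1

/-! ## The pointwise identity `(prime + archimedean)Φ = cosh(t/2)` -/

/-- **The polar term of a translate of `Φ` is the polar eigenfunction**:
`(τ_{t₀}Φ)^(0) + (τ_{t₀}Φ)^(1) = e^{t₀/2} ξ(0) + e^{-t₀/2} ξ(1) = cosh(t₀/2)` (`ξ(0) = ξ(1) = 1/2`).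
[folklore] -/
theorem weilPolarTerm_phi_translate (t₀ : ℝ) :
    weilPolarTerm (fun t : ℝ => (2 : ℂ) * LagariasMontague.Psic (2 * (t + t₀))) =
      (Real.cosh (t₀ / 2) : ℂ) := by
  obtain ⟨-, -, hmel, -⟩ := stub_phi_translate_harmonic explicit_formula_expClass' t₀
  rw [weilPolarTerm, hmel 0, hmel 1, riemannXi_zero, riemannXi_one, Complex.ofReal_cosh,
    Complex.cosh]
  push_cast
  ring_nf

/-- **`(prime + archimedean)Φ = cosh`, digamma form (RH-free)**: for every `t₀`,
`weilPrimeTerm (τ_{t₀}Φ) - weilArchTerm (τ_{t₀}Φ) = cosh(t₀/2)`.  The prime + archimedean Weil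
operator maps Riemann's kernel to the polar eigenfunction `cosh(t/2)`. [folklore] -/
theorem weilPrimeTerm_sub_weilArchTerm_phi_translate (t₀ : ℝ) :
    weilPrimeTerm (fun t : ℝ => (2 : ℂ) * LagariasMontague.Psic (2 * (t + t₀))) -
      weilArchTerm (fun t : ℝ => (2 : ℂ) * LagariasMontague.Psic (2 * (t + t₀))) =
      (Real.cosh (t₀ / 2) : ℂ) := by
  have h := phi_translate_harmonic t₀
  rw [weilFunctional, weilPolarTerm_phi_translate] at h
  linear_combination -h

/-- **`(prime + archimedean)Φ = cosh`, Bombieri form (RH-free)**: for every `t₀`,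
`cosh(t₀/2) = Σ_n Λ(n) n^{-1/2} (Φ(t₀+log n) + Φ(t₀-log n)) + (log 4π + γ) Φ(t₀)
  + ∫₀^∞ (e^{h/2}(Φ(t₀+h) + Φ(t₀-h)) - 2Φ(t₀)) / (2 sinh h) dh`,
i.e. `weilPrimeTerm (τ_{t₀}Φ) - weilArchTermBombieri (τ_{t₀}Φ) = cosh(t₀/2)` (the translate lies in
the class with rate `1`, `stub_phi_translate_harmonic`, so Bombieri's form applies). [folklore] -/
theorem weilPrimeTerm_sub_weilArchTermBombieri_phi_translate (t₀ : ℝ) :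
    weilPrimeTerm (fun t : ℝ => (2 : ℂ) * LagariasMontague.Psic (2 * (t + t₀))) -
      weilArchTermBombieri (fun t : ℝ => (2 : ℂ) * LagariasMontague.Psic (2 * (t + t₀))) =
      (Real.cosh (t₀ / 2) : ℂ) := by
  obtain ⟨hcd, ⟨C, hC⟩, -, -⟩ := stub_phi_translate_harmonic explicit_formula_expClass' t₀
  rw [weilArchTermBombieri_eq_weilArchTerm_expClass (C := C) (b₀ := 1) hcd (by norm_num)
    (fun t => (hC t).1) (fun t => (hC t).2.1) (fun t => (hC t).2.2)]
  exact weilPrimeTerm_sub_weilArchTerm_phi_translate t₀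

/-- **The identity at the origin**: `2 Σ_n Λ(n) n^{-1/2} Φ(log n) · (1/2)·2 …` — precisely
`weilPrimeTerm Φ - weilArchTermBombieri Φ = 1`, i.e.
`1 = Σ_n Λ(n) n^{-1/2} (Φ(log n) + Φ(-log n)) + (log 4π + γ) Φ(0) + ∫₀^∞ (2e^{h/2}Φ(h) - 2Φ(0))/(2 sinh h) dh`
(`Φ` is even, `cosh 0 = 1`). [folklore] -/
theorem weilPrimeTerm_sub_weilArchTermBombieri_phi :
    weilPrimeTerm (fun t : ℝ => (2 : ℂ) * LagariasMontague.Psic (2 * t)) -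
      weilArchTermBombieri (fun t : ℝ => (2 : ℂ) * LagariasMontague.Psic (2 * t)) = 1 := by
  simpa using weilPrimeTerm_sub_weilArchTermBombieri_phi_translate 0

end Summit.RiemannHypothesis.RiemannHypothesis.Theorems.GroundStatesConvergeToXi

end
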